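import Mathlib.Algebra.MvPolynomial.Basic
import Mathlib.Data.ENat.Lattice
import Literature.Computability.AlgebraicComplexity.ArithCircuit
import HarnessLib

-- provenance: harness21/H21/H21/Prelude/CplxAlg/CircuitDepth.lean @ bc880d9 (interim HEAD d8f2665); M5 mechanical rewrite
/-!
# Depth and product-depth of arithmetic circuits

(Trunk CplxAlg, notion `arithmetic_circuit`, part 2.)

Depth measures on the straight-line arithmetic circuits `Literature.Computability.AlgebraicComplexity.ArithCircuit` of
`Literature.Prelude.CplxAlg.ArithCircuit`: weighted depth `wdepth w`, depth, product-depth (the number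
of layers of multiplication gates, the parameter `Δ` of constant-depth lower bounds), edge size,
formulas, and the derived minimal-size measures `productDepthCircuitSize Δ f : ℕ∞` and
`formulaComplexity f : ℕ`.

## Sources

* N. Limaye, S. Srinivasan, S. Tavenas, *Superpolynomial lower bounds against low-depth
  algebraic circuits*, FOCS 2021, §1–§2 (product-depth `Δ`, size = number of edges/gates,
  `ΣΠΣ…` circuits).
* P. Bürgisser, *Completeness and Reduction in Algebraic Complexity Theory*, Springer 2000,
  Def. 2.1 (straight-line programs), §2.1 (formulas / expression size).
* L. Valiant, *Completeness classes in algebra*, STOC 1979 (formula size).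

## Design choices

* Depths are computed, like the semantics `ArithCircuit.gateValues`, by a *total* left fold over
  the gate list: gate `g` gets weighted depth `w g + max (depths of its operands)`, where variables,
  constants and junk (forward / out-of-range) gate references have depth `0`
  (`ArithCircuit.Operand.depthIn`). The maximum over an empty operand list is `0`.
* `depth` weighs every gate by `1`; `productDepth` weighs product gates by `1` and sum gates by
  `0`, so a `ΣΠΣΠ…` circuit with `Δ` product layers has product-depth `Δ` (LST 2021 §1).
* `IsFormula C`: every gate index is referenced at most once among all operand lists and the
  output, i.e. the underlying DAG (restricted to used gates) is a forest; spelled with a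
  `Bool`-valued `Operand.refersTo` and `List.countP` to avoid `DecidableEq k`.
* `productDepthCircuitSize Δ f` is valued in `ℕ∞` (`⨅` over a possibly empty family): for
  `Δ = 0` no circuit computes a polynomial of degree `≥ 2`. For `1 ≤ Δ` it is finite
  (`productDepthCircuitSize_ne_top`), since every polynomial is a (unbounded fan-in) sum of
  monomials (`ArithCircuit.exists_computes_productDepth_one`); no finiteness of `σ` is needed
  for this, so the `[Fintype σ]` hypothesis suggested in the outline is dropped.
* `formulaComplexity` is an `sInf` over `ℕ` like `complexity`; junk value `sInf ∅ = 0`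
  documented (the set is in fact always nonempty).
* Mathlib has no circuit-depth notion for arithmetic circuits (searched: `productDepth`,
  `circuit depth`, `formula size`, `ArithCircuit`); nothing beyond `MvPolynomial` and `ℕ∞` is
  reused.

Everything lives in `namespace Literature.CplxAlg`, inside a `noncomputable section`.
-/

noncomputable section

open MvPolynomial

namespace Literature.Computability.AlgebraicComplexity

universe u v

namespace ArithCircuit

variable {k : Type u} {σ : Type v}

section Depth

/-- The depth of an operand given the list `ds` of depths of the gates computed so far:
variables and constants have depth `0`, `gate j` has depth `ds[j]`, with the junk value `0` for an
out-of-range reference (LST 2021 §2; Bürgisser 2000, Def. 2.1). [cite: LST2021, §2] -/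
def Operand.depthIn (ds : List ℕ) : Operand k σ → ℕ
  | .var _ => 0
  | .const _ => 0
  | .gate j => ds.getD j 0

/-- The list of `w`-weighted depths of a list of gates, computed by a left fold: gate `g` has
weighted depth `w g + max (depths of its operands)` (empty maximum `= 0`), evaluated against the
depths of the gates before it (LST 2021 §2). [cite: LST2021, §2] -/
def gateWDepths (w : Gate k σ → ℕ) (gs : List (Gate k σ)) : List ℕ :=
  gs.foldl (fun ds g => ds ++ [w g + ((g.args.map (Operand.depthIn ds)).foldr max 0)]) []

/-- The `w`-weighted depth of a circuit: the weighted depth of its output operand, i.e. the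
maximum over input-output paths of the total weight of the gates on the path (LST 2021 §2). [cite: LST2021, §2] -/
def wdepth (w : Gate k σ → ℕ) (P : ArithCircuit k σ) : ℕ :=
  P.output.depthIn (gateWDepths w P.gates)

/-- The depth of a circuit: the length (number of gates) of a longest input-output path; every
gate has weight `1` (Bürgisser 2000, Def. 2.1; LST 2021 §2). [cite: Burgisser2000, Def. 2.1] -/
def depth (P : ArithCircuit k σ) : ℕ :=
  P.wdepth fun _ => 1

/-- Whether a gate is a product gate (LST 2021 §2). [cite: LST2021, §2] -/
def Gate.isProd : Gate k σ → Bool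
  | .sum _ => false
  | .prod _ => true

/-- The product-depth `Δ` of a circuit: the largest number of product gates on an input-output
path (product gates weigh `1`, sum gates `0`); a `ΣΠΣΠ⋯` circuit with `Δ` layers of products
has product-depth `Δ` (Limaye–Srinivasan–Tavenas 2021, §1). [cite: LimayeSrinivasanTavenas2021, §1] -/
def productDepth (P : ArithCircuit k σ) : ℕ :=
  P.wdepth fun g => if g.isProd then 1 else 0

/-- The edge size of a circuit: the total number of operand occurrences (wires), i.e. the sum of
the fan-ins of all gates (the size measure of LST 2021, §2). [cite: LST2021, §2] -/
def edgeSize (P : ArithCircuit k σ) : ℕ :=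
  (P.gates.map Gate.fanIn).sum

/-- Whether an operand is the reference `gate j` to gate number `j` (bookkeeping for
`ArithCircuit.IsFormula`; Bürgisser 2000, §2.1). [cite: Burgisser2000, §2.1] -/
def Operand.refersTo (j : ℕ) : Operand k σ → Bool
  | .gate i => i == j
  | _ => false

/-- All operand occurrences of a circuit: the operands of every gate, followed by the output
operand (Bürgisser 2000, Def. 2.1). [cite: Burgisser2000, Def. 2.1] -/
def operands (P : ArithCircuit k σ) : List (Operand k σ) :=
  P.gates.flatMap Gate.args ++ [P.output]

/-- A circuit is a *formula* (arithmetic expression) if every gate is used at most once: each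
gate index `j` is referenced at most once among all operand lists and the output, so that the
computation DAG is a tree (Bürgisser 2000, §2.1, expression size; Valiant 1979). [cite: Burgisser2000, §2.1  expression size] -/
def IsFormula (P : ArithCircuit k σ) : Prop :=
  ∀ j : ℕ, P.operands.countP (Operand.refersTo j) ≤ 1

end Depth

end ArithCircuit

section Measures

variable {k : Type u} {σ : Type v} [CommSemiring k]

/-- The product-depth-`Δ` circuit size of `f`: the least number of gates of an (unbounded
fan-in) arithmetic circuit of product-depth at most `Δ` computing `f`, valued in `ℕ∞` since for
`Δ = 0` no such circuit need exist (`⨅ ∅ = ⊤`); finite for `1 ≤ Δ` by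
`productDepthCircuitSize_ne_top` (Limaye–Srinivasan–Tavenas 2021, §1, Thm. 1). [cite: LimayeSrinivasanTavenas2021, §1  Thm. 1] -/
def productDepthCircuitSize (Δ : ℕ) (f : MvPolynomial σ k) : ℕ∞ :=
  ⨅ (P : ArithCircuit k σ) (_ : P.Computes f ∧ P.productDepth ≤ Δ), (P.size : ℕ∞)

/-- The formula complexity (expression size) of `f`: the least size of a fan-in-two formula
computing `f` (Bürgisser 2000, §2.1, `E(f)` up to a constant factor as for `complexity`;
Valiant 1979). The defining set is nonempty (write `f` as a tree-shaped sum of monomials);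
formally the junk value `sInf ∅ = 0` would apply otherwise. [cite: Burgisser2000, §2.1   E(f] -/
def formulaComplexity (f : MvPolynomial σ k) : ℕ :=
  sInf {s | ∃ P : ArithCircuit k σ, P.IsFormula ∧ P.IsFanInTwo ∧ P.Computes f ∧ P.size = s}

end Measures

/-! ### API lemmas -/

namespace ArithCircuit

variable {k : Type u} {σ : Type v}

/-- One step of the left fold defining `gateWDepths` (LST 2021 §2). [cite: LST2021, §2] -/
theorem gateWDepths_append_singleton (w : Gate k σ → ℕ) (gs : List (Gate k σ))
    (g : Gate k σ) :
    gateWDepths w (gs ++ [g]) = gateWDepths w gs ++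
      [w g + ((g.args.map (Operand.depthIn (gateWDepths w gs))).foldr max 0)] := by
  simp [gateWDepths, List.foldl_append]

/-- The depth list of a gate list has one entry per gate (LST 2021 §2). [cite: LST2021, §2] -/
theorem gateWDepths_length (w : Gate k σ → ℕ) (gs : List (Gate k σ)) :
    (gateWDepths w gs).length = gs.length := by
  induction gs using List.reverseRecOn with
  | nil => rfl
  | append_singleton gs g ih => simp [gateWDepths_append_singleton, ih]

/-- Input variables have depth `0` (Bürgisser 2000, Def. 2.1). [cite: Burgisser2000, Def. 2.1] -/
@[simp]
theorem depth_ofVar (i : σ) : (ofVar i : ArithCircuit k σ).depth = 0 := rfl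

/-- Constants have depth `0` (Bürgisser 2000, Def. 2.1). [cite: Burgisser2000, Def. 2.1] -/
@[simp]
theorem depth_ofConst (c : k) : (ofConst c : ArithCircuit k σ).depth = 0 := rfl

/-- Weighted depth is monotone in the (pointwise ordered) weight (LST 2021 §2). [cite: LST2021, §2] -/
def wdepth_mono : Prop :=
  ∀ {w w' : Gate k σ → ℕ} (h : ∀ g, w g ≤ w' g) (P : ArithCircuit k σ),
    P.wdepth w ≤ P.wdepth w'

/-- The product-depth is at most the depth (LST 2021 §2). [cite: LST2021, §2] -/
def productDepth_le_depth : Prop :=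
  ∀ (P : ArithCircuit k σ),
    P.productDepth ≤ P.depth

/- interim proof relied on results that are now named facts (D-0014); demoted to a fact by the M5 import, proof preserved:
:=
  wdepth_mono (fun g => by cases g <;> simp [Gate.isProd]) P
-/

/-- A fan-in-two circuit has at most twice as many wires as gates (Bürgisser 2000, Def. 2.1). [cite: Burgisser2000, Def. 2.1] -/
def edgeSize_le_two_mul_size : Prop :=
  ∀ {P : ArithCircuit k σ} (h : P.IsFanInTwo),
    P.edgeSize ≤ 2 * P.size

variable [CommSemiring k]

/-- Every polynomial is computed by a `ΣΠ` circuit of product-depth at most `1`: one product gate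
per monomial of the support and one weighted-sum gate on top (LST 2021 §1). No finiteness of the
variable type is needed. [cite: LST2021, §1] -/
def exists_computes_productDepth_one : Prop :=
  ∀ (f : MvPolynomial σ k),
    ∃ P : ArithCircuit k σ, P.WellFormed ∧ P.Computes f ∧ P.productDepth ≤ 1

/-- Every polynomial is computed by some well-formed fan-in-two formula (a tree-shaped sum of
monomials; Bürgisser 2000, §2.1). In particular the set defining `formulaComplexity f` is
nonempty. [cite: Burgisser2000, §2.1] -/
def exists_isFormula_computes : Prop :=
  ∀ (f : MvPolynomial σ k),
    ∃ P : ArithCircuit k σ, P.IsFormula ∧ P.IsFanInTwo ∧ P.WellFormed ∧ P.Computes f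

end ArithCircuit

section MeasureLemmas

variable {k : Type u} {σ : Type v} [CommSemiring k]

/-- The infimum defining `productDepthCircuitSize` is attained by every admissible circuit
(LST 2021 §1). [cite: LST2021, §1] -/
theorem productDepthCircuitSize_le {Δ : ℕ} {f : MvPolynomial σ k} {P : ArithCircuit k σ}
    (hf : P.Computes f) (hΔ : P.productDepth ≤ Δ) :
    productDepthCircuitSize Δ f ≤ P.size :=
  iInf₂_le P ⟨hf, hΔ⟩

/-- For product-depth `Δ ≥ 1` every polynomial has some circuit, so
`productDepthCircuitSize Δ f` is finite (LST 2021 §1; via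
`ArithCircuit.exists_computes_productDepth_one`). [cite: LST2021, §1] -/
def productDepthCircuitSize_ne_top : Prop :=
  ∀ {Δ : ℕ} (hΔ : 1 ≤ Δ) (f : MvPolynomial σ k),
    productDepthCircuitSize Δ f ≠ ⊤

/- interim proof relied on results that are now named facts (D-0014); demoted to a fact by the M5 import, proof preserved:
:= by
  obtain ⟨P, -, hf, hP⟩ := ArithCircuit.exists_computes_productDepth_one f
  exact ne_top_of_le_ne_top (ENat.coe_ne_top P.size)
    (productDepthCircuitSize_le hf (hP.trans hΔ))
-/

/-- Formulas are circuits: `L(f) ≤ E(f)` (Bürgisser 2000, §2.1). [cite: Burgisser2000, §2.1] -/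
def complexity_le_formulaComplexity : Prop :=
  ∀ (f : MvPolynomial σ k),
    complexity f ≤ formulaComplexity f

end MeasureLemmas

/-! ### Discharge: wires versus gates in the fan-in-two model (Bürgisser 2000, Def. 2.1)

In Bürgisser's straight-line-program model every instruction has at most two operands
(Bürgisser 2000, Def. 2.1; the same syntax as Bürgisser–Clausen–Shokrollahi 1997, Def. (4.2)(1),
whose associated multigraph has one edge `u_{iℓ} → i` per operand occurrence), so the number of
wires is the sum of the fan-ins and is at most twice the number of instructions. For
`ArithCircuit` this is the elementary estimate `∑_{g ∈ gates} fanIn g ≤ 2 · |gates|` under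
`IsFanInTwo`, proved here from the definitions (`List.sum_le_card_nsmul`). -/

namespace ArithCircuit

variable {k : Type u} {σ : Type v}

/-- The sum of the fan-ins of a list of gates each of fan-in at most `2` is at most twice the
length of the list (counting the edges `u_{iℓ} → i` of the multigraph of a straight-line program;
Bürgisser 2000, Def. 2.1, cf. Bürgisser–Clausen–Shokrollahi 1997, Def. (4.2)). [cite: Burgisser2000, Def. 2.1] -/
theorem sum_map_fanIn_le_two_mul_length {gs : List (Gate k σ)} (h : ∀ g ∈ gs, g.fanIn ≤ 2) :
    (gs.map Gate.fanIn).sum ≤ 2 * gs.length := by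
  calc (gs.map Gate.fanIn).sum ≤ (gs.map Gate.fanIn).length • 2 :=
        List.sum_le_card_nsmul _ _ fun n hn => by
          obtain ⟨g, hg, rfl⟩ := List.mem_map.1 hn
          exact h g hg
    _ = 2 * gs.length := by rw [List.length_map, smul_eq_mul, Nat.mul_comm]

/-- Discharge of the named fact `edgeSize_le_two_mul_size`: a fan-in-two circuit has at most twice
as many wires (operand occurrences) as gates, `edgeSize P ≤ 2 * size P` (Bürgisser 2000,
Def. 2.1: every instruction of a straight-line program has at most two operands). [cite: Burgisser2000, Def. 2.1] -/
theorem edgeSize_le_two_mul_size_holds : edgeSize_le_two_mul_size (k := k) (σ := σ) :=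
  fun h => sum_map_fanIn_le_two_mul_length h

end ArithCircuit

end Literature.Computability.AlgebraicComplexity
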